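import Mathlib
import Summits.CriticalPhenomena.SAWScalingLimit.Theorems.ObservableToSLE.Negative.TightnessNecessity
import Literature.Probability.RandomPlanarGeometry.ConformalRestrictionProofs
import Literature.Probability.RandomPlanarGeometry.CritPercSLESimplePathHolds
import Literature.Probability.RandomPlanarGeometry.CaratheodoryHalfPlaneProofs
import Literature.Probability.RandomPlanarGeometry.SimpleCurves
import Literature.Probability.RandomPlanarGeometry.HullRestrictionTests
import Literature.Probability.Percolation.CanonicalDiscretisationTies
import Summits.CriticalPhenomena.SAWScalingLimit.Theorems.HexConjecture.Negative.LoadBearing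

/-!
# The chordal carrier: charged under Conjecture 1, invisible to range data
# (crux `ObservableToSLE`, stmt-CriticalPhenomena-10472; stub 5 `stub_chordalCarrier` of the
# picked line `floor-ratio-restriction-bootstrap`, stub `noRetrace` of `coalescent-arc-restriction`)

Negative/structural lemmas (refuter, cdisprove gen 5).

1. `ae_mem_chordalCarrier_of_isSLELaw` — every chordal SLE_κ law with `0 < κ ≤ 4` is carried by
   `chordalCarrier D` (simple classes from `a` to `b` with trace in `D ∪ {a, b}`); composed from the
   tree's `IsSLELaw.ae_simple` (Rohde–Schramm, `ae_isSimpleTrace_sleTrace_of_le_four_holds`) and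
   `IsSLELaw.ae_endpoints` (`JordanDomain.mapsTo_boundaryExtension_holds`).
2. `chordalCarrier_of_hexConjecture` — hence the CONCLUSION of stub 5 (`ChordalCarrierOfLimits`:
   subsequential limit laws of the critical hexagonal SAW are carried by the chordal carrier), for
   EVERY Dobrushin domain and endpoint approximation, follows from `HexConjecture` alone: like the
   crux, stub 5 is not refutable short of refuting DCS Conjecture 1 as typed.
3. `isFlat_of_mk_mem_simple`, `not_isFlat_precomp_zigzag`, `exists_sameRange_not_mem_simple`,
   `exists_sameRange_not_mem_chordalCarrier`, `not_mem_chordalCarrier_of_rangeData`,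
   `exists_dirac_same_rangeData` — the NATURAL STRENGTHENING of stub 5 is FALSE: membership in the
   chordal carrier is not a function of `(range, source, target)`.  Every chordal simple class has a
   back-tracking reparametrisation (`γ ∘ zigzag`, `zigzag t = t + (8/3) t (1−t) (1−2t)`, a
   non-monotone continuous surjection of `[0,1]` fixing `0, 1`) with the same trace and endpoints
   which is NOT a simple class (a representative of a simple class is flat; `γ ∘ zigzag` is not), and
   the two Dirac laws agree on every range/endpoint event while charging the carrier `1` resp. `0`.
   CONSEQUENCE FOR PROVERS: hull-avoidance probabilities (`FloorRestrictionLimit`,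
   `AdmissibleRestrictionLimit`, LSW's `Φ_A'(0)^{5/8}`) are RANGE data; they can give "the trace is
   a.s. a simple arc from `a` to `b` in `D ∪ {a,b}`" but never simplicity of the CLASS — the content
   of stub 5 beyond its hypothesis is a lattice NO-BACKTRACKING estimate for the critical SAW.
-/

noncomputable section

open Literature.Probability.RandomPlanarGeometry Literature.Probability.RandomPlanarGeometry.SAW
  Literature.Probability.LatticeModels MeasureTheory Filter Topology Set unitInterval
open scoped NNReal ENNReal

namespace Summit.CriticalPhenomena.SAWScalingLimit.Theorems.ObservableToSLE.Negative

open Summit.CriticalPhenomena.SAWScalingLimit.Theses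

/-! ### 1–2. SLE laws with `κ ≤ 4` charge the chordal carrier; stub 5's conclusion from Conj. 1 -/

/-- Every chordal SLE_κ law in `(D; a, b)` with `0 < κ ≤ 4` is carried by the chordal carrier of
`D` (Rohde–Schramm simplicity + Carathéodory endpoints, both discharged in the tree). [folklore] -/
theorem ae_mem_chordalCarrier_of_isSLELaw {κ : ℝ≥0} (h0 : 0 < κ) (h4 : κ ≤ 4)
    {D : DobrushinDomain} {μ : Measure (CurveClass ℂ)} (h : IsSLELaw κ D μ) :
    ∀ᵐ c ∂μ, c ∈ chordalCarrier D := by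
  filter_upwards [IsSLELaw.ae_endpoints JordanDomain.mapsTo_boundaryExtension_holds h,
    IsSLELaw.ae_simple ae_isSimpleTrace_sleTrace_of_le_four_holds
      CurveClass.measurableSet_simple_holds h0 h4 h] with c h1 h2
  obtain ⟨hs, ht, hr⟩ := h1
  obtain ⟨hsim, hfr⟩ := h2
  refine ⟨⟨⟨hsim, hs⟩, ht⟩, fun w hw => ?_⟩
  have hw' := hr hw
  rw [closure_eq_self_union_frontier] at hw'
  rcases hw' with h' | h'
  · exact Or.inl h'
  · exact Or.inr (hfr ⟨hw, h'⟩)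

/-- The case `κ = 8/3`. [folklore] -/
theorem ae_mem_chordalCarrier_of_isSLELaw_eightThirds {D : DobrushinDomain}
    {μ : Measure (CurveClass ℂ)} (h : IsSLELaw ((8 : ℝ≥0) / 3) D μ) :
    ∀ᵐ c ∂μ, c ∈ chordalCarrier D := by
  refine ae_mem_chordalCarrier_of_isSLELaw (by positivity) ?_ h
  rw [div_le_iff₀ (by norm_num : (0 : ℝ≥0) < 3)]
  norm_num

/-- STUB 5's CONCLUSION FROM CONJECTURE 1: under `HexConjecture`, every subsequential limit law of
the critical hexagonal SAW curve classes — in EVERY Dobrushin domain, for EVERY endpoint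
approximation — is carried by the chordal carrier.  (So `stub_chordalCarrier`, `noRetrace`-type
stubs and every "range → curve" step are consequences of DCS Conjecture 1 and cannot be refuted
independently of it.) [folklore] -/
theorem chordalCarrier_of_hexConjecture (h : SAWDevelopingMap.HexConjecture)
    (D : DobrushinDomain) (a b : ℝ → HexVertex) (hab : IsEmbEndpointApprox hexGraph hexCenter D a b)
    (μ : Measure (CurveClass ℂ)) (hμ : IsProbabilityMeasure μ)
    (hsub : IsSubseqLimitLaw (fun δ (γ : HexDomainSAW D.carrier δ (a δ) (b δ)) => γ.curve)
      (fun δ => hexSAWLaw D.carrier δ (a δ) (b δ)) μ) :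
    ∀ᵐ c ∂μ, c ∈ chordalCarrier D :=
  ae_mem_chordalCarrier_of_isSLELaw_eightThirds
    ((hexConjecture_iff_tight_and_identification.1 h).2 D a b hab μ hμ hsub)

/-! ### 3. Range data do not see simplicity of the class -/

/-- A representative of a SIMPLE class is flat (takes equal values at `s ≤ t` only if constant on
`[s, t]`): every representative has all injectivity moduli. [folklore] -/
theorem isFlat_of_mk_mem_simple {E : Type*} [MetricSpace E] {γ : Curve E}
    (h : CurveClass.mk γ ∈ (CurveClass.simple : Set (CurveClass E))) : γ.IsFlat := by
  rw [CurveClass.simple_eq_iInter] at h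
  obtain ⟨-, h⟩ := h
  simp only [mem_iInter, mem_iUnion] at h
  refine Curve.isFlat_of_forall_mem_modulusSet fun ε hε => ?_
  obtain ⟨n, hn⟩ := exists_nat_one_div_lt hε
  obtain ⟨m, hm⟩ := h n
  exact ⟨1 / (m + 1 : ℝ), by positivity,
    Curve.modulusSet_mono hn.le le_rfl (CurveClass.mem_modulusSet_of_mk_mem hm)⟩

/-- The back-tracking reparametrisation `t ↦ t + (8/3) t (1 − t) (1 − 2t)` as a real function. -/
def zigzagFun (t : ℝ) : ℝ := t + 8 / 3 * t * (1 - t) * (1 - 2 * t)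

/-- `zigzagFun` is continuous (a polynomial). [folklore] -/
theorem continuous_zigzagFun : Continuous zigzagFun := by
  unfold zigzagFun; fun_prop

/-- Sum-of-squares form `zigzagFun t = t ((4t−3)² + 2)/3` (non-negativity on `[0, ∞)`). [folklore] -/
theorem zigzagFun_eq (t : ℝ) : zigzagFun t = t * ((4 * t - 3) ^ 2 + 2) / 3 := by
  unfold zigzagFun; ring

/-- Sum-of-squares form `1 − zigzagFun t = (1−t)((4t−1)² + 2)/3` (bound `≤ 1` on `(−∞, 1]`). [folklore] -/
theorem one_sub_zigzagFun_eq (t : ℝ) : 1 - zigzagFun t = (1 - t) * ((4 * t - 1) ^ 2 + 2) / 3 := by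
  unfold zigzagFun; ring

/-- `zigzagFun ≥ 0` on `[0, ∞)`. [folklore] -/
theorem zigzagFun_nonneg {t : ℝ} (ht : 0 ≤ t) : 0 ≤ zigzagFun t := by
  rw [zigzagFun_eq]; positivity

/-- `zigzagFun ≤ 1` on `(−∞, 1]`. [folklore] -/
theorem zigzagFun_le_one {t : ℝ} (ht : t ≤ 1) : zigzagFun t ≤ 1 := by
  have h : 0 ≤ 1 - zigzagFun t := by
    rw [one_sub_zigzagFun_eq]
    have : 0 ≤ 1 - t := sub_nonneg.2 ht
    positivity
  linarith

/-- `zigzagFun 0 = 0`. [folklore] -/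
@[simp] theorem zigzagFun_zero : zigzagFun 0 = 0 := by norm_num [zigzagFun]
/-- `zigzagFun 1 = 1`. [folklore] -/
@[simp] theorem zigzagFun_one : zigzagFun 1 = 1 := by norm_num [zigzagFun]
/-- `zigzagFun (1/4) = 1/2`. [folklore] -/
theorem zigzagFun_quarter : zigzagFun (1 / 4) = 1 / 2 := by norm_num [zigzagFun]
/-- `zigzagFun (3/4) = 1/2`: the map is not injective. [folklore] -/
theorem zigzagFun_three_quarters : zigzagFun (3 / 4) = 1 / 2 := by norm_num [zigzagFun]
/-- `zigzagFun (1/3) = 43/81 ≠ 1/2`: the map is not monotone. [folklore] -/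
theorem zigzagFun_third : zigzagFun (1 / 3) = 43 / 81 := by norm_num [zigzagFun]

/-- The zigzag as a continuous self-map of `[0, 1]`: increasing on `[0, ·]`, then DEcreasing
(`zigzag (1/4) = zigzag (3/4) = 1/2 ≠ 43/81 = zigzag (1/3)`), then increasing; fixes `0` and `1`,
surjective, not monotone. [folklore] -/
def zigzag : C(I, I) where
  toFun t := ⟨zigzagFun t, zigzagFun_nonneg t.2.1, zigzagFun_le_one t.2.2⟩
  continuous_toFun := (continuous_zigzagFun.comp continuous_subtype_val).subtype_mk _

/-- Pointwise formula for `zigzag`. [folklore] -/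
@[simp] theorem zigzag_apply_coe (t : I) : (zigzag t : ℝ) = zigzagFun t := rfl

/-- `zigzag` fixes `0`. [folklore] -/
theorem zigzag_zero : zigzag 0 = 0 := Subtype.ext (by simp)

/-- `zigzag` fixes `1`. [folklore] -/
theorem zigzag_one : zigzag 1 = 1 := Subtype.ext (by simp)

/-- `zigzag` is onto `[0, 1]` (intermediate values between its fixed endpoints). [folklore] -/
theorem surjective_zigzag : Function.Surjective zigzag := by
  intro y
  have hy : (y : ℝ) ∈ Icc (zigzagFun 0) (zigzagFun 1) := by
    rw [zigzagFun_zero, zigzagFun_one]; exact y.2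
  obtain ⟨t, ht, hty⟩ :=
    intermediate_value_Icc zero_le_one continuous_zigzagFun.continuousOn hy
  exact ⟨⟨t, ht⟩, Subtype.ext hty⟩

/-- The parameter `1/4 ∈ [0, 1]`. [folklore] -/
def tQuarter : I := ⟨1 / 4, by norm_num, by norm_num⟩

/-- The parameter `1/3 ∈ [0, 1]`. [folklore] -/
def tThird : I := ⟨1 / 3, by norm_num, by norm_num⟩

/-- The parameter `3/4 ∈ [0, 1]`. [folklore] -/
def tThreeQuarters : I := ⟨3 / 4, by norm_num, by norm_num⟩

/-- `zigzag (1/4) = zigzag (3/4)`. [folklore] -/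
theorem zigzag_tQuarter_eq_tThreeQuarters : zigzag tQuarter = zigzag tThreeQuarters := by
  apply Subtype.ext
  show zigzagFun (1 / 4) = zigzagFun (3 / 4)
  rw [zigzagFun_quarter, zigzagFun_three_quarters]

/-- `zigzag (1/3) ≠ zigzag (1/4)`. [folklore] -/
theorem zigzag_tThird_ne_tQuarter : zigzag tThird ≠ zigzag tQuarter := by
  intro h
  have h' := congrArg Subtype.val h
  simp only [zigzag_apply_coe, tThird, tQuarter, zigzagFun_third, zigzagFun_quarter] at h'
  norm_num at h'

/-- **Back-tracking destroys flatness**: if `γ` is injective then `γ ∘ zigzag` is not flat — it takes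
the value `γ (1/2)` at the parameters `1/4 < 3/4` and the different value `γ (43/81)` at `1/3`. -/
theorem not_isFlat_precomp_zigzag {E : Type*} [TopologicalSpace E] {γ : Curve E}
    (hγ : γ.IsSimple) : ¬ (γ.precomp zigzag).IsFlat := by
  intro h
  have hsu : tQuarter ≤ tThird := Subtype.mk_le_mk.2 (by norm_num)
  have hut : tThird ≤ tThreeQuarters := Subtype.mk_le_mk.2 (by norm_num)
  have hst : γ.precomp zigzag tQuarter = γ.precomp zigzag tThreeQuarters := by
    simp only [Curve.precomp_apply, zigzag_tQuarter_eq_tThreeQuarters]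
  have key := h tQuarter tThird tThreeQuarters hsu hut hst
  simp only [Curve.precomp_apply] at key
  exact zigzag_tThird_ne_tQuarter (hγ key)

/-- The back-tracked curve has the same trace. -/
theorem range_precomp_zigzag {E : Type*} [TopologicalSpace E] (γ : Curve E) :
    (γ.precomp zigzag).range = γ.range := by
  show Set.range (fun t => γ (zigzag t)) = Set.range γ
  exact surjective_zigzag.range_comp γ

/-- The back-tracked curve has the same source. [folklore] -/
theorem source_precomp_zigzag {E : Type*} [TopologicalSpace E] (γ : Curve E) :
    (γ.precomp zigzag).source = γ.source := by
  simp only [Curve.source_def, Curve.precomp_apply, zigzag_zero]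

/-- The back-tracked curve has the same target. [folklore] -/
theorem target_precomp_zigzag {E : Type*} [TopologicalSpace E] (γ : Curve E) :
    (γ.precomp zigzag).target = γ.target := by
  simp only [Curve.target_def, Curve.precomp_apply, zigzag_one]

/-- **Every injective curve has a non-simple back-tracking with the same trace and endpoints.** -/
theorem exists_sameRange_not_mem_simple {E : Type*} [MetricSpace E] {γ : Curve E}
    (hγ : γ.IsSimple) :
    ∃ γ' : Curve E, γ'.range = γ.range ∧ γ'.source = γ.source ∧ γ'.target = γ.target ∧
      CurveClass.mk γ' ∉ (CurveClass.simple : Set (CurveClass E)) :=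
  ⟨γ.precomp zigzag, range_precomp_zigzag γ, source_precomp_zigzag γ, target_precomp_zigzag γ,
    fun h => not_isFlat_precomp_zigzag hγ (isFlat_of_mk_mem_simple h)⟩

/-- **Every class of the chordal carrier has a shadow outside it with identical range data**: same
trace, same endpoints, not simple (hence not in the carrier of ANY domain). -/
theorem exists_sameRange_not_mem_chordalCarrier {D : DobrushinDomain} {c : CurveClass ℂ}
    (hc : c ∈ chordalCarrier D) :
    ∃ c' : CurveClass ℂ, c'.range = c.range ∧ c'.source = c.source ∧ c'.target = c.target ∧
      c' ∉ (CurveClass.simple : Set (CurveClass ℂ)) ∧ ∀ D' : DobrushinDomain, c' ∉ chordalCarrier D' := by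
  obtain ⟨⟨⟨⟨γ, hγ, rfl⟩, -⟩, -⟩, -⟩ := hc
  obtain ⟨γ', h1, h2, h3, h4⟩ := exists_sameRange_not_mem_simple hγ
  refine ⟨CurveClass.mk γ', ?_, ?_, ?_, h4, fun D' h => h4 h.1.1.1⟩
  · simpa using h1
  · simpa using h2
  · simpa using h3

/-! #### A concrete inhabitant: the diameter of the unit disc -/

/-- The diameter `t ↦ 1 − 2t` of the unit disc from `1` to `−1`. -/
def diameterCurve : Curve ℂ :=
  ⟨⟨fun t : I => ((1 - 2 * (t : ℝ) : ℝ) : ℂ),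
    Complex.continuous_ofReal.comp
      (continuous_const.sub (continuous_const.mul continuous_subtype_val))⟩⟩

/-- Pointwise formula for the diameter. [folklore] -/
@[simp] theorem diameterCurve_apply (t : I) : diameterCurve t = ((1 - 2 * (t : ℝ) : ℝ) : ℂ) := rfl

/-- The diameter is injective. [folklore] -/
theorem isSimple_diameterCurve : diameterCurve.IsSimple := by
  intro s t h
  simp only [diameterCurve_apply, Complex.ofReal_inj] at h
  exact Subtype.ext (by linarith)

/-- The diameter class lies in the chordal carrier of `(𝔻; 1, −1)`. -/
theorem diameter_mem_chordalCarrier :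
    CurveClass.mk diameterCurve ∈ chordalCarrier DobrushinDomain.unitDisc := by
  refine ⟨⟨⟨CurveClass.mk_mem_simple isSimple_diameterCurve, ?_⟩, ?_⟩, ?_⟩
  · show diameterCurve.source = DobrushinDomain.unitDisc.pt 0
    rw [Literature.Probability.Percolation.unitDisc_pt_zero, Curve.source_def, diameterCurve_apply]
    simp
  · show diameterCurve.target = DobrushinDomain.unitDisc.pt 1
    rw [Summit.CriticalPhenomena.SAWScalingLimit.Cruxes.HexConjecture.Negative.unitDisc_pt_one, Curve.target_def, diameterCurve_apply]
    push_cast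
    norm_num
  · show Set.range diameterCurve ⊆ DobrushinDomain.unitDisc.carrier ∪
      {DobrushinDomain.unitDisc.pt 0, DobrushinDomain.unitDisc.pt 1}
    rw [Literature.Probability.Percolation.unitDisc_pt_zero, Summit.CriticalPhenomena.SAWScalingLimit.Cruxes.HexConjecture.Negative.unitDisc_pt_one]
    rintro _ ⟨t, rfl⟩
    obtain ⟨t, ht0, ht1⟩ := t
    rcases ht0.eq_or_lt with rfl | h0
    · right; simp
    rcases ht1.eq_or_lt with rfl | h1
    · right; simp; norm_num
    left
    show ((1 - 2 * t : ℝ) : ℂ) ∈ Metric.ball (0 : ℂ) 1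
    rw [Metric.mem_ball, dist_zero_right, Complex.norm_real, Real.norm_eq_abs, abs_lt]
    constructor <;> linarith

/-- **THE NATURAL STRENGTHENING OF STUB 5 IS FALSE**: membership in the chordal carrier is not
determined by `(range, source, target)` — witnessed on the unit disc by the diameter and its
back-tracking. -/
theorem not_mem_chordalCarrier_of_rangeData :
    ¬ ∀ (D : DobrushinDomain) (c c' : CurveClass ℂ), c ∈ chordalCarrier D →
        c'.range = c.range → c'.source = c.source → c'.target = c.target → c' ∈ chordalCarrier D := by
  intro h
  obtain ⟨c', h1, h2, h3, -, h5⟩ := exists_sameRange_not_mem_chordalCarrier diameter_mem_chordalCarrier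
  exact h5 _ (h _ _ c' diameter_mem_chordalCarrier h1 h2 h3)

/-- Measure form: two PROBABILITY laws on curve classes agreeing on every range event
`{range ⊆ S}`, every source event and every target event (in particular with identical
hull-avoidance probabilities), one carried by the chordal carrier, the other giving it mass `0`. -/
theorem exists_dirac_same_rangeData :
    ∃ μ₁ μ₂ : Measure (CurveClass ℂ), IsProbabilityMeasure μ₁ ∧ IsProbabilityMeasure μ₂ ∧
      (∀ S : Set ℂ, μ₁ {c | c.range ⊆ S} = μ₂ {c | c.range ⊆ S}) ∧
      (∀ z : ℂ, μ₁ {c | c.source = z} = μ₂ {c | c.source = z}) ∧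
      (∀ z : ℂ, μ₁ {c | c.target = z} = μ₂ {c | c.target = z}) ∧
      μ₁ (chordalCarrier DobrushinDomain.unitDisc) = 1 ∧
      μ₂ (chordalCarrier DobrushinDomain.unitDisc) = 0 := by
  obtain ⟨c', h1, h2, h3, -, h5⟩ := exists_sameRange_not_mem_chordalCarrier diameter_mem_chordalCarrier
  refine ⟨Measure.dirac (CurveClass.mk diameterCurve), Measure.dirac c', inferInstance, inferInstance,
    fun S => ?_, fun z => ?_, fun z => ?_, ?_, ?_⟩
  · rw [Measure.dirac_apply, Measure.dirac_apply]
    by_cases hS : c'.range ⊆ S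
    · have hd : CurveClass.mk diameterCurve ∈ {c : CurveClass ℂ | c.range ⊆ S} := by
        show (CurveClass.mk diameterCurve).range ⊆ S
        rw [← h1]; exact hS
      rw [Set.indicator_of_mem hd, Set.indicator_of_mem (show c' ∈ {c : CurveClass ℂ | c.range ⊆ S} from hS)]
      rfl
    · have hd : CurveClass.mk diameterCurve ∉ {c : CurveClass ℂ | c.range ⊆ S} := by
        show ¬ (CurveClass.mk diameterCurve).range ⊆ S
        rw [← h1]; exact hS
      rw [Set.indicator_of_notMem hd, Set.indicator_of_notMem (show c' ∉ {c : CurveClass ℂ | c.range ⊆ S} from hS)]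
  · simp only [Measure.dirac_apply, Set.indicator_apply, mem_setOf_eq, h2, Pi.one_apply]
  · simp only [Measure.dirac_apply, Set.indicator_apply, mem_setOf_eq, h3, Pi.one_apply]
  · exact Measure.dirac_apply_of_mem diameter_mem_chordalCarrier
  · rw [Measure.dirac_apply, Set.indicator_of_notMem (h5 _)]

end Summit.CriticalPhenomena.SAWScalingLimit.Theorems.ObservableToSLE.Negative
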